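import Literature.MathematicalPhysics.QuantumManyBody.PeriodicBoseGas
import Literature.MathematicalPhysics.QuantumManyBody.PeriodicBoseGasFourier
import Literature.MathematicalPhysics.QuantumManyBody.GroundState
import Literature.MathematicalPhysics.QuantumManyBody.SwapPurity
import Summits.AtomisticToContinuum.BoseEinsteinCondensation.Theorems.BECInsertionVarianceGroundStateAccessibleExistence
import Summits.AtomisticToContinuum.BoseEinsteinCondensation.Theorems.BECThomsonPrinciplePeriodicToDirichletInnerFlatToBEC
import Mathlib.MeasureTheory.Measure.WithDensity
import Mathlib.Analysis.SpecialFunctions.Exp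
import Mathlib.Analysis.SpecialFunctions.Pow.Real

/-!
# Crux `BoundaryTransferWeak` (stmt-AtomisticToContinuum-0827, routes `BECInsertionCorrector` /
# `BECPeriodicReduction`), line `Sketch` (coupled-bath-relocation): stub `stub_boxTransfer`

**Box transfer (the coupling arithmetic).**  `Ψ_D = groundState v (n+1) L` (law `Q = Ψ_D² dZ`,
mass one when `E₀ < ⊤`), `Φ` a periodic trial state (law `P = |Φ|² 1_{cell} dW`), `C` the inner
cube, `u = |C|^{-1/2} 1_C`.  A coupling `π` of `Q, P` whose good event `G` (relocation cost `≤ e^M`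
between the slices `ψ = Ψ_D(·, tail Z)`, `φ = |Φ(·, tail W)|` off a small `S ⊆ C`) has mass
`≥ 1 - η`, and a `P`-event `E` of mass `≥ c/16` on which `φ` is Bhattacharyya-flat on `C`, give
`n_u(Ψ_D) ≥ κ(n+1)`: (1) `n_u/(n+1) = ∫ |⟨u, ψ_Y⟩|² dY ≥ E_Q[F]`, `F = 1_C(Z 0)(∫_C ψ)²/(|C|∫_C ψ²)`
(Tonelli, pointwise in `Y`); (2) `E_Q[F] = ∫ F∘fst dπ ≥ κ₀ π(G ∩ snd⁻¹E) ≥ κ₀ (c/16 - η)`;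
(3) on `G ∩ snd⁻¹E`, `F ≥ κ₀ = e^{-2M}(1-ε)(√c/4-ε)²` by the multiplicative flatness transfer on
`C ∖ S`, `∫_{C∖S} ψ² ≥ (1-ε)∫_C ψ²` and `∫_{C∖S} φ ≥ (√c/4 - ε)(|C|∫_C φ²)^{1/2}`. [folklore]
-/

noncomputable section

namespace Summit.AtomisticToContinuum.BoseEinsteinCondensation.CoupledBaths

open Literature.MathematicalPhysics.QuantumManyBody.BoseGas MeasureTheory Filter
open scoped ENNReal NNReal ComplexConjugate

/-- `Y ↦ ∫_Q G(x :: Y) dx` is measurable (Tonelli; as in `…TorusTypicality`). [folklore] -/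
private theorem measurable_setLIntegral_vecCons {n : ℕ} {G : Config (n + 1) → ℝ≥0∞}
    (hG : Measurable G) (Q : Set Space) :
    Measurable fun Y : Config n => ∫⁻ x in Q, G (Matrix.vecCons x Y) :=
  (hG.comp (measurable_vecCons.comp measurable_swap)).lintegral_prod_right'

/-- Cauchy–Schwarz against `1`: `(∫_C f)² ≤ |C| ∫_C f²` (as in `…TorusTypicality`). [folklore] -/
private theorem sq_setLIntegral_le {f : Space → ℝ≥0∞} (hf : Measurable f) (C : Set Space) :
    (∫⁻ y in C, f y) ^ 2 ≤ volume C * ∫⁻ y in C, f y ^ 2 := by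
  have h := lintegral_mul_sq_le (volume.restrict C) (f := f) (g := fun _ => 1)
    hf.aemeasurable aemeasurable_const; rw [mul_comm]
  simpa only [mul_one, one_pow, lintegral_one, Measure.restrict_apply_univ] using h

/-- Square roots in `ℝ≥0∞`: `α²T ≤ a²`, `b² ≤ β²T`, `0 ≤ β ≤ α`, `T < ⊤` give `(α-β)²T ≤ (a-b)²`.
[folklore] -/
private theorem sq_tsub_ge {a b T : ℝ≥0∞} {α β : ℝ} (hβ : 0 ≤ β) (hβα : β ≤ α) (hT : T ≠ ⊤)
    (ha : ENNReal.ofReal (α ^ 2) * T ≤ a ^ 2) (hb : b ^ 2 ≤ ENNReal.ofReal (β ^ 2) * T) :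
    ENNReal.ofReal ((α - β) ^ 2) * T ≤ (a - b) ^ 2 := by
  have hbt : b ≠ ⊤ := by
    rintro rfl
    rw [ENNReal.top_pow two_ne_zero, top_le_iff] at hb
    exact ENNReal.mul_ne_top ENNReal.ofReal_ne_top hT hb
  rcases eq_or_ne a ⊤ with rfl | hat
  · rw [ENNReal.top_sub hbt, ENNReal.top_pow two_ne_zero]; exact le_top
  obtain ⟨a', ha0, rfl⟩ : ∃ a' : ℝ, 0 ≤ a' ∧ a = ENNReal.ofReal a' :=
    ⟨a.toReal, ENNReal.toReal_nonneg, (ENNReal.ofReal_toReal hat).symm⟩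
  obtain ⟨b', hb0, rfl⟩ : ∃ b' : ℝ, 0 ≤ b' ∧ b = ENNReal.ofReal b' :=
    ⟨b.toReal, ENNReal.toReal_nonneg, (ENNReal.ofReal_toReal hbt).symm⟩
  obtain ⟨s, hs0, rfl⟩ : ∃ s : ℝ, 0 ≤ s ∧ T = ENNReal.ofReal (s ^ 2) :=
    ⟨Real.sqrt T.toReal, Real.sqrt_nonneg _,
      by rw [Real.sq_sqrt ENNReal.toReal_nonneg, ENNReal.ofReal_toReal hT]⟩
  rw [← ENNReal.ofReal_pow ha0, ← ENNReal.ofReal_mul (sq_nonneg _), ← mul_pow,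
    ENNReal.ofReal_le_ofReal_iff (by positivity),
    pow_le_pow_iff_left₀ (mul_nonneg (hβ.trans hβα) hs0) ha0 two_ne_zero] at ha
  rw [← ENNReal.ofReal_pow hb0, ← ENNReal.ofReal_mul (sq_nonneg _), ← mul_pow,
    ENNReal.ofReal_le_ofReal_iff (by positivity),
    pow_le_pow_iff_left₀ hb0 (mul_nonneg hβ hs0) two_ne_zero] at hb
  have h3 : (α - β) * s ≤ a' - b' := by nlinarith
  have h4 : 0 ≤ (α - β) * s := mul_nonneg (by linarith) hs0
  rw [← ENNReal.ofReal_sub _ hb0, ← ENNReal.ofReal_pow (by linarith),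
    ← ENNReal.ofReal_mul (sq_nonneg _), ← mul_pow, ENNReal.ofReal_le_ofReal_iff (by positivity)]
  exact pow_le_pow_left₀ h4 h3 2

/-- Mass-one coupling: `π G ≥ 1 - η` and `π T ≥ c'` give `π (G ∩ T) ≥ c' - η`. [folklore] -/
private theorem le_measure_inter_of_compl {Ω : Type*} [MeasurableSpace Ω] {π : Measure Ω}
    (hπ : π Set.univ = 1) {G T : Set Ω} (hG : MeasurableSet G) {η c' : ℝ} (hη : 0 ≤ η)
    (hGπ : ENNReal.ofReal (1 - η) ≤ π G) (hT : ENNReal.ofReal c' ≤ π T) :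
    ENNReal.ofReal (c' - η) ≤ π (G ∩ T) := by
  have hcompl : π Gᶜ ≤ ENNReal.ofReal η := by
    refine (ENNReal.add_le_add_iff_right (a := ENNReal.ofReal (1 - η)) ENNReal.ofReal_ne_top).mp ?_
    calc π Gᶜ + ENNReal.ofReal (1 - η) ≤ π Gᶜ + π G := add_le_add le_rfl hGπ
      _ = 1 := by rw [add_comm, measure_add_measure_compl hG, hπ]
      _ = ENNReal.ofReal (η + (1 - η)) := by rw [add_sub_cancel, ENNReal.ofReal_one]
      _ ≤ ENNReal.ofReal η + ENNReal.ofReal (1 - η) := ENNReal.ofReal_add_le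
  have hsplit : π T ≤ π (G ∩ T) + π Gᶜ :=
    calc π T = π (T ∩ G) + π (T \ G) := (measure_inter_add_sdiff _ hG).symm
      _ ≤ π (G ∩ T) + π Gᶜ :=
          add_le_add (by rw [Set.inter_comm]) (measure_mono fun x hx => hx.2)
  rw [ENNReal.ofReal_sub _ hη]
  exact (tsub_le_tsub hT hcompl).trans (tsub_le_iff_right.mpr hsplit)

/-- **One slice of the disintegration** (pointwise in the bath, degenerate slices included):
`(∫_C ψ²) (∫_C ψ)² / (|C| ∫_C ψ²) ≤ |⟨u, ψ⟩|²` for `ψ ≥ 0`, `|C| = a²`, `u = a⁻¹ 1_C`. [folklore] -/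
private theorem slice_bound {C : Set Space} (hC : MeasurableSet C) {a : ℝ} (ha : 0 < a)
    (hV : volume C = ENNReal.ofReal (a ^ 2)) {ψ : Space → ℝ} (hψ : Measurable ψ)
    (hψ0 : ∀ x, 0 ≤ ψ x) :
    (∫⁻ x in C, ENNReal.ofReal (ψ x) ^ 2) *
        ((∫⁻ x in C, ENNReal.ofReal (ψ x)) ^ 2 /
          (volume C * ∫⁻ x in C, ENNReal.ofReal (ψ x) ^ 2)) ≤
      (‖∫ x, conj (C.indicator (fun _ => ((a : ℂ))⁻¹) x) * (ψ x : ℂ)‖₊ : ℝ≥0∞) ^ 2 := by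
  set V : ℝ≥0∞ := volume C with hVdef
  set J : ℝ≥0∞ := ∫⁻ x in C, ENNReal.ofReal (ψ x) with hJ
  set m : ℝ≥0∞ := ∫⁻ x in C, ENNReal.ofReal (ψ x) ^ 2 with hm
  have hV0 : V ≠ 0 := by rw [hV]; exact (ENNReal.ofReal_pos.mpr (by positivity)).ne'
  rcases eq_or_ne m 0 with hm0 | hm0
  · rw [hm0, zero_mul]; exact zero_le
  rcases eq_or_ne m ⊤ with hmt | hmt
  · rw [hmt, ENNReal.mul_top hV0, ENNReal.div_top, mul_zero]; exact zero_le
  rw [mul_comm V m, ← mul_div_assoc, ENNReal.mul_div_mul_left _ _ hm0 hmt]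
  -- `J` is finite (Cauchy–Schwarz), so `ψ` is integrable on `C`
  have hJ2 : J ^ 2 ≤ V * m := sq_setLIntegral_le hψ.ennreal_ofReal C
  have hJt : J ≠ ⊤ := fun h => by
    rw [h, ENNReal.top_pow two_ne_zero, top_le_iff] at hJ2
    exact ENNReal.mul_ne_top (hV ▸ ENNReal.ofReal_ne_top) hmt hJ2
  have hint : Integrable ψ (volume.restrict C) := by
    refine ⟨hψ.aestronglyMeasurable, ?_⟩
    rw [HasFiniteIntegral]
    calc ∫⁻ x in C, ‖ψ x‖ₑ = J := lintegral_congr fun x => Real.enorm_eq_ofReal (hψ0 x)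
      _ < ⊤ := hJt.lt_top
  have hIeq : ENNReal.ofReal (∫ x in C, ψ x) = J :=
    ofReal_integral_eq_lintegral_ofReal hint (Eventually.of_forall fun x => hψ0 x)
  -- the pairing with the flat mode
  have hI : (∫ x, conj (C.indicator (fun _ => ((a : ℂ))⁻¹) x) * (ψ x : ℂ)) =
      ((a⁻¹ * ∫ x in C, ψ x : ℝ) : ℂ) := by
    have h : (fun x => conj (C.indicator (fun _ => ((a : ℂ))⁻¹) x) * (ψ x : ℂ)) =
        C.indicator (fun x => ((a⁻¹ * ψ x : ℝ) : ℂ)) := by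
      funext x
      by_cases hx : x ∈ C
      · simp [Set.indicator_of_mem hx]
      · simp [hx]
    rw [h, integral_indicator hC, integral_complex_ofReal, integral_const_mul]
  rw [hI, Complex.nnnorm_real, ← enorm_eq_nnnorm,
    Real.enorm_eq_ofReal (mul_nonneg (inv_nonneg.mpr ha.le) (integral_nonneg hψ0)),
    ENNReal.ofReal_mul (inv_nonneg.mpr ha.le), hIeq, ENNReal.ofReal_inv_of_pos ha, mul_pow,
    ← ENNReal.inv_pow, ← ENNReal.ofReal_pow ha.le, ← hV, div_eq_mul_inv, mul_comm]

/-- **`E_Q` of a first-particle/bath functional** (Tonelli in `Z = x :: Y`):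
`∫ 1_C(Z 0) B(tail Z) g(Z)² dZ = ∫ (∫_C g(x :: Y)² dx) B(Y) dY`. [folklore] -/
private theorem lintegral_indicator_mul_withDensity {n : ℕ} {g : Config (n + 1) → ℝ}
    (hg : Measurable g) {C : Set Space} (hC : MeasurableSet C) {B : Config n → ℝ≥0∞}
    (hB : Measurable B) :
    ∫⁻ Z, C.indicator (fun _ => (1 : ℝ≥0∞)) (Z 0) * B (Matrix.vecTail Z)
        ∂(volume.withDensity fun Z => ENNReal.ofReal (g Z) ^ 2) =
      ∫⁻ Y, (∫⁻ x in C, ENNReal.ofReal (g (Matrix.vecCons x Y)) ^ 2) * B Y := by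
  have hρ : Measurable fun Z => ENNReal.ofReal (g Z) ^ 2 := hg.ennreal_ofReal.pow_const 2
  have hF : Measurable fun Z : Config (n + 1) =>
      C.indicator (fun _ => (1 : ℝ≥0∞)) (Z 0) * B (Matrix.vecTail Z) :=
    ((measurable_const.indicator hC).comp (measurable_pi_apply 0)).mul
      (hB.comp measurable_vecTail)
  rw [lintegral_withDensity_eq_lintegral_mul _ hρ hF, lintegral_config_succ (hρ.mul hF)]
  refine lintegral_congr fun Y => ?_
  simp only [Pi.mul_apply, Matrix.cons_val_zero, Matrix.tail_cons]
  have hm : Measurable fun x => ENNReal.ofReal (g (Matrix.vecCons x Y)) ^ 2 :=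
    hρ.comp (continuous_id.matrixVecCons continuous_const).measurable
  rw [← lintegral_mul_const _ hm, ← lintegral_indicator hC]
  exact lintegral_congr fun x => by by_cases hx : x ∈ C <;> simp [hx]

/-- **The pointwise core of the box transfer**: under `MFT`, the good-event and torus-typicality
hypotheses on the slices `ψ, φ` give `(∫_C ψ)² ≥ e^{-2M}(1-ε)(√c/4-ε)² |C| ∫_C ψ²`. [folklore] -/
private theorem flatness_core
    (MFT : ∀ (C : Set Space) (f g : Space → ℝ) (M : ℝ), MeasurableSet C → Measurable f →
      Measurable g → (∀ x ∈ C, 0 ≤ f x) → (∀ x ∈ C, 0 ≤ g x) →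
      (∀ x ∈ C, ∀ y ∈ C, f x * g y ≤ Real.exp M * (f y * g x)) →
        (∫⁻ x in C, ENNReal.ofReal (g x)) ^ 2 * ∫⁻ x in C, ENNReal.ofReal (f x) ^ 2 ≤
          ENNReal.ofReal (Real.exp (2 * M)) *
            ((∫⁻ x in C, ENNReal.ofReal (f x)) ^ 2 * ∫⁻ x in C, ENNReal.ofReal (g x) ^ 2))
    {C S : Set Space} {ψ φ : Space → ℝ} {c ε M : ℝ} (hC : MeasurableSet C) (hVt : volume C ≠ ⊤)
    (hψm : Measurable ψ) (hφm : Measurable φ) (hψ0 : ∀ x, 0 ≤ ψ x) (hφ0 : ∀ x, 0 ≤ φ x)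
    (hc : 0 < c) (hε : 0 < ε) (hεc : ε ≤ Real.sqrt c / 8) (hε1 : ε ≤ 1 / 2)
    (hmt : ∫⁻ x in C, ENNReal.ofReal (ψ x) ^ 2 < ⊤) (hmφ0 : 0 < ∫⁻ y in C, ENNReal.ofReal (φ y) ^ 2)
    (hmφt : ∫⁻ y in C, ENNReal.ofReal (φ y) ^ 2 < ⊤)
    (hflat : ENNReal.ofReal (c / 16) * (volume C * ∫⁻ y in C, ENNReal.ofReal (φ y) ^ 2) ≤
      (∫⁻ y in C, ENNReal.ofReal (φ y)) ^ 2)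
    (hSC : S ⊆ C) (hS : MeasurableSet S) (hvolS : volume S ≤ ENNReal.ofReal ε * volume C)
    (hSψ : ∫⁻ x in S, ENNReal.ofReal (ψ x) ^ 2 ≤
      ENNReal.ofReal ε * ∫⁻ x in C, ENNReal.ofReal (ψ x) ^ 2)
    (hSφ : ∫⁻ y in S, ENNReal.ofReal (φ y) ^ 2 ≤
      ENNReal.ofReal ε * ∫⁻ y in C, ENNReal.ofReal (φ y) ^ 2)
    (hpair : ∀ x ∈ C \ S, ∀ y ∈ C \ S, ψ x * φ y ≤ Real.exp M * (ψ y * φ x)) :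
    ENNReal.ofReal (Real.exp (-2 * M) * ((1 - ε) * (Real.sqrt c / 4 - ε) ^ 2)) *
        (volume C * ∫⁻ x in C, ENNReal.ofReal (ψ x) ^ 2) ≤
      (∫⁻ x in C, ENNReal.ofReal (ψ x)) ^ 2 := by
  set V : ℝ≥0∞ := volume C with hVdef
  set J : ℝ≥0∞ := ∫⁻ x in C, ENNReal.ofReal (ψ x) with hJdef
  set m : ℝ≥0∞ := ∫⁻ x in C, ENNReal.ofReal (ψ x) ^ 2 with hmdef
  set Jφ : ℝ≥0∞ := ∫⁻ y in C, ENNReal.ofReal (φ y) with hJφdef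
  set mφ : ℝ≥0∞ := ∫⁻ y in C, ENNReal.ofReal (φ y) ^ 2 with hmφdef
  have hsplit (f : Space → ℝ≥0∞) : (∫⁻ x in S, f x) + ∫⁻ x in C \ S, f x = ∫⁻ x in C, f x := by
    simpa only [Set.inter_eq_self_of_subset_right hSC] using
      lintegral_inter_add_sdiff (μ := volume) f C hS
  -- the multiplicative transfer on `C ∖ S`
  have hMFT := MFT (C \ S) ψ φ M (hC.diff hS) hψm hφm (fun x _ => hψ0 x) (fun x _ => hφ0 x) hpair
  have h1 : (∫⁻ x in C \ S, ENNReal.ofReal (ψ x)) ≤ J := lintegral_mono_set Set.sdiff_subset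
  have h2 : (∫⁻ x in C \ S, ENNReal.ofReal (φ x) ^ 2) ≤ mφ := lintegral_mono_set Set.sdiff_subset
  -- `∫_{C∖S} ψ² ≥ (1 - ε) ∫_C ψ²`
  have hmA : ENNReal.ofReal (1 - ε) * m ≤ ∫⁻ x in C \ S, ENNReal.ofReal (ψ x) ^ 2 := by
    refine (ENNReal.add_le_add_iff_right (a := ENNReal.ofReal ε * m)
      (ENNReal.mul_ne_top ENNReal.ofReal_ne_top hmt.ne)).mp ?_
    calc ENNReal.ofReal (1 - ε) * m + ENNReal.ofReal ε * m = m := by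
          rw [← add_mul, ← ENNReal.ofReal_add (by linarith) hε.le, sub_add_cancel,
            ENNReal.ofReal_one, one_mul]
      _ = (∫⁻ x in S, ENNReal.ofReal (ψ x) ^ 2) + ∫⁻ x in C \ S, ENNReal.ofReal (ψ x) ^ 2 :=
          (hsplit fun x => ENNReal.ofReal (ψ x) ^ 2).symm
      _ ≤ (∫⁻ x in C \ S, ENNReal.ofReal (ψ x) ^ 2) + ENNReal.ofReal ε * m := by
          rw [add_comm]; exact add_le_add le_rfl hSψ
  -- `∫_{C∖S} φ = ∫_C φ - ∫_S φ` with `(∫_S φ)² ≤ ε² |C| ∫_C φ²`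
  have hVmφ : V * mφ ≠ ⊤ := ENNReal.mul_ne_top hVt hmφt.ne
  have hJφS : (∫⁻ y in S, ENNReal.ofReal (φ y)) ^ 2 ≤ ENNReal.ofReal (ε ^ 2) * (V * mφ) :=
    calc (∫⁻ y in S, ENNReal.ofReal (φ y)) ^ 2 ≤ volume S * ∫⁻ y in S, ENNReal.ofReal (φ y) ^ 2 :=
          sq_setLIntegral_le hφm.ennreal_ofReal S
      _ ≤ (ENNReal.ofReal ε * V) * (ENNReal.ofReal ε * mφ) := mul_le_mul' hvolS hSφ
      _ = ENNReal.ofReal (ε ^ 2) * (V * mφ) := by rw [sq, ENNReal.ofReal_mul hε.le]; ring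
  have hJφSt : (∫⁻ y in S, ENNReal.ofReal (φ y)) ≠ ⊤ := fun h => by
    rw [h, ENNReal.top_pow two_ne_zero, top_le_iff] at hJφS
    exact ENNReal.mul_ne_top ENNReal.ofReal_ne_top hVmφ hJφS
  have hJφA : (∫⁻ y in C \ S, ENNReal.ofReal (φ y)) = Jφ - ∫⁻ y in S, ENNReal.ofReal (φ y) := by
    rw [hJφdef, ← hsplit fun y => ENNReal.ofReal (φ y), ENNReal.add_sub_cancel_left hJφSt]
  have hflat' : ENNReal.ofReal ((Real.sqrt c / 4) ^ 2) * (V * mφ) ≤ Jφ ^ 2 := by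
    rwa [div_pow, Real.sq_sqrt hc.le, show c / 4 ^ 2 = c / 16 by norm_num]
  have hkey : ENNReal.ofReal ((Real.sqrt c / 4 - ε) ^ 2) * (V * mφ) ≤
      (∫⁻ y in C \ S, ENNReal.ofReal (φ y)) ^ 2 := by
    rw [hJφA]
    exact sq_tsub_ge hε.le (by linarith [Real.sqrt_nonneg c]) hVmφ hflat' hJφS
  -- combine and cancel `mφ ∈ (0, ⊤)`
  have hcomb : ENNReal.ofReal ((1 - ε) * (Real.sqrt c / 4 - ε) ^ 2) * (V * m) * mφ ≤
      ENNReal.ofReal (Real.exp (2 * M)) * J ^ 2 * mφ :=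
    calc ENNReal.ofReal ((1 - ε) * (Real.sqrt c / 4 - ε) ^ 2) * (V * m) * mφ
        = ENNReal.ofReal ((Real.sqrt c / 4 - ε) ^ 2) * (V * mφ) *
            (ENNReal.ofReal (1 - ε) * m) := by rw [ENNReal.ofReal_mul (by linarith)]; ring
      _ ≤ (∫⁻ y in C \ S, ENNReal.ofReal (φ y)) ^ 2 * ∫⁻ x in C \ S, ENNReal.ofReal (ψ x) ^ 2 :=
          mul_le_mul' hkey hmA
      _ ≤ ENNReal.ofReal (Real.exp (2 * M)) * ((∫⁻ x in C \ S, ENNReal.ofReal (ψ x)) ^ 2 *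
            ∫⁻ x in C \ S, ENNReal.ofReal (φ x) ^ 2) := hMFT
      _ ≤ ENNReal.ofReal (Real.exp (2 * M)) * (J ^ 2 * mφ) := by gcongr
      _ = ENNReal.ofReal (Real.exp (2 * M)) * J ^ 2 * mφ := by ring
  have hcancel : ENNReal.ofReal ((1 - ε) * (Real.sqrt c / 4 - ε) ^ 2) * (V * m) ≤
      ENNReal.ofReal (Real.exp (2 * M)) * J ^ 2 :=
    (ENNReal.mul_le_mul_iff_left hmφ0.ne' hmφt.ne).mp hcomb
  calc ENNReal.ofReal (Real.exp (-2 * M) * ((1 - ε) * (Real.sqrt c / 4 - ε) ^ 2)) * (V * m)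
      = ENNReal.ofReal (Real.exp (-2 * M)) *
          (ENNReal.ofReal ((1 - ε) * (Real.sqrt c / 4 - ε) ^ 2) * (V * m)) := by
        rw [ENNReal.ofReal_mul (Real.exp_pos _).le, mul_assoc]
    _ ≤ ENNReal.ofReal (Real.exp (-2 * M)) * (ENNReal.ofReal (Real.exp (2 * M)) * J ^ 2) :=
        mul_le_mul' le_rfl hcancel
    _ = J ^ 2 := by
        rw [← mul_assoc, ← ENNReal.ofReal_mul (Real.exp_pos _).le, ← Real.exp_add,
          show -2 * M + 2 * M = 0 by ring, Real.exp_zero, ENNReal.ofReal_one, one_mul]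

/-- **Registered stub `stub_boxTransfer`** (B of line `Sketch`, crux stmt-AtomisticToContinuum-0827;
the skeleton's `BoxTransfer`, unfolded): the multiplicative flatness transfer, a coupling with a
good event of mass `≥ 1 - η` and a torus-typical event of mass `≥ c/16` give inner flat-mode
occupation `≥ κ(c,ε,η,M)·(n+1)` of the Dirichlet ground state. [folklore] -/
theorem stub_boxTransfer :
    (∀ (C : Set Space) (f g : Space → ℝ) (M : ℝ), MeasurableSet C → Measurable f → Measurable g →
      (∀ x ∈ C, 0 ≤ f x) → (∀ x ∈ C, 0 ≤ g x) →
      (∀ x ∈ C, ∀ y ∈ C, f x * g y ≤ Real.exp M * (f y * g x)) →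
        (∫⁻ x in C, ENNReal.ofReal (g x)) ^ 2 * ∫⁻ x in C, ENNReal.ofReal (f x) ^ 2 ≤
          ENNReal.ofReal (Real.exp (2 * M)) *
            ((∫⁻ x in C, ENNReal.ofReal (f x)) ^ 2 * ∫⁻ x in C, ENNReal.ofReal (g x) ^ 2)) →
    ∀ (v : ℝ → ℝ≥0∞) (n : ℕ) (L : ℝ), 0 < L → groundStateEnergy v (n + 1) L ≠ ⊤ →
    ∀ (c ε η M : ℝ), 0 < c → 0 < ε → ε ≤ Real.sqrt c / 8 → ε ≤ 1 / 2 → 0 < η → η < c / 16 →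
    ∀ Φ : PeriodicTrialState (n + 1) L,
      (∃ π : Measure (Config (n + 1) × Config (n + 1)),
        π.map Prod.fst = volume.withDensity (fun Z => ENNReal.ofReal (groundState v (n + 1) L Z) ^ 2) ∧
        π.map Prod.snd = ((volume.restrict (cellN (n + 1) L)).withDensity fun W => (‖Φ.ψ W‖₊ : ℝ≥0∞) ^ 2) ∧
        ∃ G : Set (Config (n + 1) × Config (n + 1)), MeasurableSet G ∧
          ENNReal.ofReal (1 - η) ≤ π G ∧
          ∀ p ∈ G,
              (p.1 0 ∈ {x : Space | ∀ t, x t ∈ Set.Ioo (1 / 4 * L) (L - 1 / 4 * L)} ↔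
                p.2 0 ∈ {x : Space | ∀ t, x t ∈ Set.Ioo (1 / 4 * L) (L - 1 / 4 * L)}) ∧
              0 < ∫⁻ x in {x : Space | ∀ t, x t ∈ Set.Ioo (1 / 4 * L) (L - 1 / 4 * L)},
                ENNReal.ofReal (groundState v (n + 1) L (Matrix.vecCons x (Matrix.vecTail p.1))) ^ 2 ∧
              ∫⁻ x in {x : Space | ∀ t, x t ∈ Set.Ioo (1 / 4 * L) (L - 1 / 4 * L)},
                ENNReal.ofReal (groundState v (n + 1) L (Matrix.vecCons x (Matrix.vecTail p.1))) ^ 2 < ⊤ ∧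
              ∃ S ⊆ {x : Space | ∀ t, x t ∈ Set.Ioo (1 / 4 * L) (L - 1 / 4 * L)},
                MeasurableSet S ∧
                volume S ≤ ENNReal.ofReal ε * volume {x : Space | ∀ t, x t ∈ Set.Ioo (1 / 4 * L) (L - 1 / 4 * L)} ∧
                ∫⁻ x in S, ENNReal.ofReal (groundState v (n + 1) L (Matrix.vecCons x (Matrix.vecTail p.1))) ^ 2 ≤
                  ENNReal.ofReal ε * ∫⁻ x in {x : Space | ∀ t, x t ∈ Set.Ioo (1 / 4 * L) (L - 1 / 4 * L)},
                    ENNReal.ofReal (groundState v (n + 1) L (Matrix.vecCons x (Matrix.vecTail p.1))) ^ 2 ∧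
                ∫⁻ y in S, ENNReal.ofReal ‖Φ.ψ (Matrix.vecCons y (Matrix.vecTail p.2))‖ ^ 2 ≤
                  ENNReal.ofReal ε * ∫⁻ y in {x : Space | ∀ t, x t ∈ Set.Ioo (1 / 4 * L) (L - 1 / 4 * L)},
                    ENNReal.ofReal ‖Φ.ψ (Matrix.vecCons y (Matrix.vecTail p.2))‖ ^ 2 ∧
                ∀ x ∈ {x : Space | ∀ t, x t ∈ Set.Ioo (1 / 4 * L) (L - 1 / 4 * L)} \ S,
                  ∀ y ∈ {x : Space | ∀ t, x t ∈ Set.Ioo (1 / 4 * L) (L - 1 / 4 * L)} \ S,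
                    groundState v (n + 1) L (Matrix.vecCons x (Matrix.vecTail p.1)) * ‖Φ.ψ (Matrix.vecCons y (Matrix.vecTail p.2))‖ ≤
                      Real.exp M * (groundState v (n + 1) L (Matrix.vecCons y (Matrix.vecTail p.1)) * ‖Φ.ψ (Matrix.vecCons x (Matrix.vecTail p.2))‖)) →
      (∃ E : Set (Config (n + 1)), MeasurableSet E ∧
        ENNReal.ofReal (c / 16) ≤ ((volume.restrict (cellN (n + 1) L)).withDensity fun W => (‖Φ.ψ W‖₊ : ℝ≥0∞) ^ 2) E ∧
        ∀ W ∈ E,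
            W 0 ∈ {x : Space | ∀ t, x t ∈ Set.Ioo (1 / 4 * L) (L - 1 / 4 * L)} ∧
            0 < ∫⁻ y in {x : Space | ∀ t, x t ∈ Set.Ioo (1 / 4 * L) (L - 1 / 4 * L)},
                ENNReal.ofReal ‖Φ.ψ (Matrix.vecCons y (Matrix.vecTail W))‖ ^ 2 ∧
            ENNReal.ofReal (c / 16) *
                (volume {x : Space | ∀ t, x t ∈ Set.Ioo (1 / 4 * L) (L - 1 / 4 * L)} *
                  ∫⁻ y in {x : Space | ∀ t, x t ∈ Set.Ioo (1 / 4 * L) (L - 1 / 4 * L)},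
                    ENNReal.ofReal ‖Φ.ψ (Matrix.vecCons y (Matrix.vecTail W))‖ ^ 2) ≤
              (∫⁻ y in {x : Space | ∀ t, x t ∈ Set.Ioo (1 / 4 * L) (L - 1 / 4 * L)},
                  ENNReal.ofReal ‖Φ.ψ (Matrix.vecCons y (Matrix.vecTail W))‖) ^ 2) →
      ENNReal.ofReal ((c / 16 - η) * (Real.exp (-2 * M) * ((1 - ε) * (Real.sqrt c / 4 - ε) ^ 2)) / 2 *
          (n + 1 : ℕ)) ≤
        occupation (n + 1)
          (Set.indicator {x : Space | ∀ t, x t ∈ Set.Ioo (1 / 4 * L) (L - 1 / 4 * L)}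
          (fun _ => ((Real.sqrt (((1 - 2 * (1 / 4)) * L) ^ 3))⁻¹ : ℂ)))
          fun Z => (groundState v (n + 1) L Z : ℂ) := by
  intro MFT v n L hL hE c ε η M hc hε hεc hε1 hη hηc Φ hπ hEev
  obtain ⟨π, hπ1, hπ2, G, hG, hGπ, hgood⟩ := hπ
  obtain ⟨E, hEm, hEP, hEgood⟩ := hEev
  -- the inner cube, its volume `a²`, the ground state
  set C : Set Space := {x : Space | ∀ t, x t ∈ Set.Ioo (1 / 4 * L) (L - 1 / 4 * L)} with hCdef
  set a : ℝ := Real.sqrt (((1 - 2 * (1 / 4)) * L) ^ 3) with hadef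
  set gs : Config (n + 1) → ℝ := groundState v (n + 1) L with hgsdef
  have hCmeas : MeasurableSet C := TorusInTheBox.measurableSet_innerCube (1 / 4) L
  have hCcell : C ⊆ cell L := fun x hx k =>
    ⟨by linarith [(hx k).1, (hx k).2], by linarith [(hx k).1, (hx k).2]⟩
  have ha0 : 0 < a := Real.sqrt_pos.mpr (by positivity)
  have hV : volume C = ENNReal.ofReal (a ^ 2) := by
    rw [hCdef, TorusInTheBox.volume_innerCube (1 / 4) L, hadef, Real.sq_sqrt (by positivity),
      ENNReal.ofReal_pow (by linarith)]
  have hV0 : volume C ≠ 0 := by rw [hV]; exact (ENNReal.ofReal_pos.mpr (by positivity)).ne'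
  have hVt : volume C ≠ ⊤ := by rw [hV]; exact ENNReal.ofReal_ne_top
  have hgm : Measurable gs := measurable_groundState v (n + 1) L
  have hg0 : ∀ Z, 0 ≤ gs Z := groundState_nonneg v (n + 1) L
  have hslm : ∀ Y : Config n, Measurable fun x : Space => gs (Matrix.vecCons x Y) := fun Y =>
    hgm.comp (continuous_id.matrixVecCons continuous_const).measurable
  -- the functional `F(Z) = 1_C(Z 0) · (∫_C ψ_{tail Z})² / (|C| ∫_C ψ_{tail Z}²)`
  set B : Config n → ℝ≥0∞ := fun Y => (∫⁻ x in C, ENNReal.ofReal (gs (Matrix.vecCons x Y))) ^ 2 /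
    (volume C * ∫⁻ x in C, ENNReal.ofReal (gs (Matrix.vecCons x Y)) ^ 2) with hBdef
  have hBm : Measurable B :=
    ((measurable_setLIntegral_vecCons hgm.ennreal_ofReal C).pow_const 2).div
      ((measurable_setLIntegral_vecCons (hgm.ennreal_ofReal.pow_const 2) C).const_mul _)
  set F : Config (n + 1) → ℝ≥0∞ := fun Z =>
    C.indicator (fun _ => (1 : ℝ≥0∞)) (Z 0) * B (Matrix.vecTail Z) with hFdef
  have hFm : Measurable F := ((measurable_const.indicator hCmeas).comp
    (measurable_pi_apply 0)).mul (hBm.comp measurable_vecTail)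
  -- (1) one-bath disintegration: `E_Q[F] ≤ ∫ |⟨u, ψ_Y⟩|² dY`
  have hEQ : ∫⁻ Z, F Z ∂(volume.withDensity fun Z => ENNReal.ofReal (gs Z) ^ 2) ≤
      ∫⁻ Y : Config n, (‖∫ x, conj (C.indicator (fun _ => ((a : ℂ))⁻¹) x) *
        (gs (Matrix.vecCons x Y) : ℂ)‖₊ : ℝ≥0∞) ^ 2 := by
    rw [hFdef, lintegral_indicator_mul_withDensity hgm hCmeas hBm]
    exact lintegral_mono fun Y => slice_bound hCmeas ha0 hV (hslm Y) fun x => hg0 _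
  -- (2) the coupling: `π` has mass one and `π(G ∩ snd⁻¹ E) ≥ c/16 - η`
  have hπuniv : π Set.univ = 1 := by
    have h : π.map Prod.fst Set.univ = π Set.univ := by
      rw [Measure.map_apply measurable_fst MeasurableSet.univ, Set.preimage_univ]
    rw [← h, hπ1, withDensity_apply _ MeasurableSet.univ, Measure.restrict_univ]
    exact Theorems.BECInsertionVariance.lintegral_groundState_sq_of_ne_top hE
  have hT : ENNReal.ofReal (c / 16) ≤ π (Prod.snd ⁻¹' E) := by
    rw [← Measure.map_apply measurable_snd hEm, hπ2]; exact hEP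
  have hGT : ENNReal.ofReal (c / 16 - η) ≤ π (G ∩ Prod.snd ⁻¹' E) :=
    le_measure_inter_of_compl hπuniv hG hη.le hGπ hT
  -- (3) the pointwise core on `G ∩ snd⁻¹ E`
  set κ₀ : ℝ := Real.exp (-2 * M) * ((1 - ε) * (Real.sqrt c / 4 - ε) ^ 2) with hκ₀def
  have hcore : ∀ p ∈ G ∩ Prod.snd ⁻¹' E, ENNReal.ofReal κ₀ ≤ F p.1 := by
    intro p hp
    obtain ⟨hiff, hm0, hmt, S, hSC, hS, hvolS, hSψ, hSφ, hpair⟩ := hgood p hp.1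
    obtain ⟨hW0, hmφ0, hflat⟩ := hEgood p.2 hp.2
    rw [hFdef]
    simp only [Set.indicator_of_mem (hiff.mpr hW0), one_mul, hBdef]
    have hφc : Continuous fun y : Space => Φ.ψ (Matrix.vecCons y (Matrix.vecTail p.2)) :=
      Φ.contDiff.continuous.comp (continuous_id.matrixVecCons continuous_const)
    have hmφt :
        ∫⁻ y in C, ENNReal.ofReal ‖Φ.ψ (Matrix.vecCons y (Matrix.vecTail p.2))‖ ^ 2 < ⊤ := by
      refine lt_of_le_of_lt (lintegral_mono_set hCcell) (lt_of_eq_of_lt (lintegral_congr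
        fun y => ?_) (integrableOn_sq_cell L
          (φ := fun y : Space => Φ.ψ (Matrix.vecCons y (Matrix.vecTail p.2))) hφc).2)
      rw [Real.enorm_eq_ofReal (sq_nonneg _), ENNReal.ofReal_pow (norm_nonneg _)]
    refine (ENNReal.le_div_iff_mul_le (Or.inl (mul_ne_zero hV0 hm0.ne'))
      (Or.inl (ENNReal.mul_ne_top hVt hmt.ne))).mpr ?_
    exact flatness_core MFT (ψ := fun x => gs (Matrix.vecCons x (Matrix.vecTail p.1)))
      (φ := fun y => ‖Φ.ψ (Matrix.vecCons y (Matrix.vecTail p.2))‖) hCmeas hVt (hslm _)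
      hφc.norm.measurable (fun x => hg0 _) (fun y => norm_nonneg _) hc hε hεc hε1 hmt hmφ0 hmφt
      hflat hSC hS hvolS hSψ hSφ hpair
  -- (4) assemble: `κ₀ (c/16 - η) ≤ E_Q[F] ≤ n_u / (n+1)`
  have hmain : ENNReal.ofReal κ₀ * ENNReal.ofReal (c / 16 - η) ≤
      ∫⁻ Z, F Z ∂(volume.withDensity fun Z => ENNReal.ofReal (gs Z) ^ 2) :=
    calc ENNReal.ofReal κ₀ * ENNReal.ofReal (c / 16 - η)
        ≤ ENNReal.ofReal κ₀ * π (G ∩ Prod.snd ⁻¹' E) := mul_le_mul' le_rfl hGT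
      _ = ∫⁻ _ in G ∩ Prod.snd ⁻¹' E, ENNReal.ofReal κ₀ ∂π := (setLIntegral_const _ _).symm
      _ ≤ ∫⁻ p in G ∩ Prod.snd ⁻¹' E, F p.1 ∂π := setLIntegral_mono (hFm.comp measurable_fst) hcore
      _ ≤ ∫⁻ p, F p.1 ∂π := setLIntegral_le_lintegral _ _
      _ = ∫⁻ Z, F Z ∂(π.map Prod.fst) := (lintegral_map hFm measurable_fst).symm
      _ = _ := by rw [hπ1]
  have hκ₀ : 0 ≤ κ₀ := mul_nonneg (Real.exp_pos _).le (mul_nonneg (by linarith) (sq_nonneg _))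
  have hcη : 0 ≤ c / 16 - η := by linarith
  have hκ : (c / 16 - η) * κ₀ / 2 * ((n + 1 : ℕ) : ℝ) ≤ κ₀ * (c / 16 - η) * ((n + 1 : ℕ) : ℝ) :=
    mul_le_mul_of_nonneg_right (by nlinarith [mul_nonneg hcη hκ₀]) (Nat.cast_nonneg _)
  calc ENNReal.ofReal ((c / 16 - η) * κ₀ / 2 * ((n + 1 : ℕ) : ℝ))
      ≤ ENNReal.ofReal (κ₀ * (c / 16 - η) * ((n + 1 : ℕ) : ℝ)) := ENNReal.ofReal_le_ofReal hκ
    _ = ENNReal.ofReal κ₀ * ENNReal.ofReal (c / 16 - η) * ((n + 1 : ℕ) : ℝ≥0∞) := by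
        rw [ENNReal.ofReal_mul (mul_nonneg hκ₀ hcη), ENNReal.ofReal_mul hκ₀, ENNReal.ofReal_natCast]
    _ ≤ _ := mul_le_mul' (hmain.trans hEQ) le_rfl
    _ = _ := by rw [mul_comm]; push_cast; rfl

end Summit.AtomisticToContinuum.BoseEinsteinCondensation.CoupledBaths

end
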